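import Summits.AtomisticToContinuum.BoseEinsteinCondensation.Theorems.BECThomsonPrinciplePeriodicToDirichletResidual
import Summits.AtomisticToContinuum.BoseEinsteinCondensation.Theses.BECPeriodicReduction

/-!
# `BoundaryTransferWeak` (stmt-AtomisticToContinuum-0827) from the reward-free residual of line `reward-pays-the-wall`

The shared per-potential crux `BECPeriodicReduction.BoundaryTransferWeak` (stmt-0827: for each repulsive finite-range
`v`, torus BEC of the periodic near-minimisers at all small densities ⟹ `HasGroundStateBEC v ρ` at all small densities)
is the pointwise-in-`v` form of `BECThomsonPrinciple.PeriodicToDirichlet` (stmt-9483, which follows from it by the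
landed one-liner `periodicToDirichlet_of_boundaryTransferWeak`). The line `reward-pays-the-wall` of the 9483 crux chain is
pointwise in `v` throughout, so its landed output serves 0827 verbatim; this file records that, so that work on 0827 starts
from the residual and does not re-derive the transfer:

* `boundaryTransferAt_of_condensedToBECAt` — for ONE admissible `v`: if "condensed competitors suffice" at `v`
  (`∃ ρ₄ > 0, ∀ ρ ∈ (0, ρ₄), ∀ c ∈ (0, 1]`: flat-condensed Dirichlet trial states within `θN` of `E₀^D(N, L_N(ρ))` for
  every `θ > 0` ⟹ `HasGroundStateBEC v ρ`), then torus BEC at `v` (the hypothesis of `BoundaryTransferWeak v`, i.e.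
  `∃ ρ₀ > 0, ∀ ρ ∈ (0, ρ₀), ∃ c > 0, TorusBECAt v ρ c`) gives Dirichlet BEC at `v` at all small densities. Proof: the landed
  transfer `stub_transfer` (`TorusBECAt v ρ c → RewardedUpperBound v ρ (min c 1)`, p85115 over p74246–p76612) and, below
  the density cap of `exists_density_cap_tendsto_e0`, `eventually_exists_condensed_of_rewardedUpperBound`.
* `boundaryTransferWeak_of_condensedToBEC` — hence `BoundaryTransferWeak` from the residual for every `v`
  (the same hypothesis as `periodicToDirichlet_of_condensedToBEC`).
* `boundaryTransferAt_of_upperBoundToBECAt`, `boundaryTransferWeak_of_upperBoundToBEC`, `boundaryTransferWeak_of_unrewarding`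
  — the same in the line's reward vocabulary (`RewardedUpperBound`, `Unrewarding`).
* `boundaryTransferAt_zero` — the `v = 0` instance of 0827 holds outright (`hasGroundStateBEC_zero`, p70676).

What remains for 0827 is therefore exactly what remains for 9483: the residual "condensed competitors suffice" in one
Dirichlet cube, for `v ≠ 0` (ground-state BEC given condensed competitors `o(N)` above `E₀^D`; LSSY 2005 App. D, open
converse of (D.17); no soft proof: `Theorems/PeriodicToDirichlet/Negative/SoftUnrewardingSchema`).

References: E. H. Lieb, R. Seiringer, J. P. Solovej, J. Yngvason, *The Mathematics of the Bose Gas and its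
Condensation* (2005), §1.2, Ch. 5, App. D.
-/

noncomputable section

open MeasureTheory Filter
open scoped ENNReal NNReal Topology

namespace Summit.AtomisticToContinuum.BoseEinsteinCondensation.RewardPaysTheWall

open Literature.MathematicalPhysics.QuantumManyBody.BoseGas

/-- **Per-potential transfer from the residual.** For one repulsive finite-range `v`: if condensed competitors
suffice at `v` (for `ρ < ρ₄`, `0 < c ≤ 1`: flat-condensed Dirichlet trial states within `θN` of `E₀^D` for every
`θ > 0` imply `HasGroundStateBEC v ρ`), then torus BEC at `v` at all small densities implies Dirichlet ground-state
BEC at `v` at all small densities, with `ρ₀ = min (ρ_A, ρ₁, ρ₂, ρ₄)` (`ρ₁` from `stub_transfer`, `ρ₂` the density cap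
of `exists_density_cap_tendsto_e0`). [folklore] -/
theorem boundaryTransferAt_of_condensedToBECAt {v : ℝ → ℝ≥0∞} (hv : IsRepulsiveFiniteRange v)
    (h : ∃ ρ₄ : ℝ, 0 < ρ₄ ∧ ∀ ρ : ℝ, 0 < ρ → ρ < ρ₄ → ∀ c : ℝ, 0 < c → c ≤ 1 →
      (∀ θ : ℝ, 0 < θ → ∀ᶠ N : ℕ in atTop, ∃ Ψ : TrialState N (sideLength ρ N),
        energy v Ψ ≤ groundStateEnergy v N (sideLength ρ N) + ENNReal.ofReal (θ * N) ∧
          ENNReal.ofReal ((c - θ) * N) ≤ occupation N (boxConstantMode (sideLength ρ N)) Ψ.ψ) →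
      HasGroundStateBEC v ρ)
    (hA : ∃ ρ₀ : ℝ, 0 < ρ₀ ∧ ∀ ρ : ℝ, 0 < ρ → ρ < ρ₀ → ∃ c : ℝ, 0 < c ∧ TorusBECAt v ρ c) :
    ∃ ρ₀ : ℝ, 0 < ρ₀ ∧ ∀ ρ : ℝ, 0 < ρ → ρ < ρ₀ → HasGroundStateBEC v ρ := by
  obtain ⟨ρA, hρA, HA⟩ := hA
  obtain ⟨ρ₁, hρ₁, H1⟩ := stub_transfer v hv
  obtain ⟨ρ₂, hρ₂, H2⟩ := exists_density_cap_tendsto_e0 v hv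
  obtain ⟨ρ₄, hρ₄, H4⟩ := h
  refine ⟨min (min ρA ρ₁) (min ρ₂ ρ₄), lt_min (lt_min hρA hρ₁) (lt_min hρ₂ hρ₄),
    fun ρ hρ hlt => ?_⟩
  obtain ⟨c, hc, hT⟩ := HA ρ hρ (hlt.trans_le ((min_le_left _ _).trans (min_le_left _ _)))
  obtain ⟨he, hTD, -⟩ := H2 ρ hρ (hlt.trans_le ((min_le_right _ _).trans (min_le_left _ _)))
  have hU : RewardedUpperBound v ρ (min c 1) :=
    H1 ρ hρ (hlt.trans_le ((min_le_left _ _).trans (min_le_right _ _))) c hc hT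
  exact H4 ρ hρ (hlt.trans_le ((min_le_right _ _).trans (min_le_right _ _))) (min c 1)
    (lt_min hc one_pos) (min_le_right c 1)
    (fun θ hθ => eventually_exists_condensed_of_rewardedUpperBound he hTD (lt_min hc one_pos)
      (min_le_right c 1) hU hθ)

/-- **`BoundaryTransferWeak` (stmt-0827) from the reward-free residual** "condensed competitors suffice" for every
admissible `v` (verbatim the hypothesis of `periodicToDirichlet_of_condensedToBEC`). [folklore] -/
theorem boundaryTransferWeak_of_condensedToBEC
    (h : ∀ v : ℝ → ℝ≥0∞, IsRepulsiveFiniteRange v → ∃ ρ₄ : ℝ, 0 < ρ₄ ∧ ∀ ρ : ℝ, 0 < ρ → ρ < ρ₄ →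
      ∀ c : ℝ, 0 < c → c ≤ 1 →
        (∀ θ : ℝ, 0 < θ → ∀ᶠ N : ℕ in atTop, ∃ Ψ : TrialState N (sideLength ρ N),
          energy v Ψ ≤ groundStateEnergy v N (sideLength ρ N) + ENNReal.ofReal (θ * N) ∧
            ENNReal.ofReal ((c - θ) * N) ≤ occupation N (boxConstantMode (sideLength ρ N)) Ψ.ψ) →
        HasGroundStateBEC v ρ) :
    Summit.AtomisticToContinuum.BoseEinsteinCondensation.Theses.BECPeriodicReduction.BoundaryTransferWeak :=
  fun v hv hA => boundaryTransferAt_of_condensedToBECAt hv (h v hv) hA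

/-- **Per-potential transfer from the rewarded residual** (line vocabulary): if at `v`, for `ρ < ρ₄` and
`0 < c ≤ 1`, `RewardedUpperBound v ρ c → HasGroundStateBEC v ρ`, then torus BEC at `v` gives Dirichlet BEC at `v`
at all small densities (`stub_transfer` only; no density cap needed). [folklore] -/
theorem boundaryTransferAt_of_upperBoundToBECAt {v : ℝ → ℝ≥0∞} (hv : IsRepulsiveFiniteRange v)
    (h : ∃ ρ₄ : ℝ, 0 < ρ₄ ∧ ∀ ρ : ℝ, 0 < ρ → ρ < ρ₄ →
      ∀ c : ℝ, 0 < c → c ≤ 1 → RewardedUpperBound v ρ c → HasGroundStateBEC v ρ)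
    (hA : ∃ ρ₀ : ℝ, 0 < ρ₀ ∧ ∀ ρ : ℝ, 0 < ρ → ρ < ρ₀ → ∃ c : ℝ, 0 < c ∧ TorusBECAt v ρ c) :
    ∃ ρ₀ : ℝ, 0 < ρ₀ ∧ ∀ ρ : ℝ, 0 < ρ → ρ < ρ₀ → HasGroundStateBEC v ρ := by
  obtain ⟨ρA, hρA, HA⟩ := hA
  obtain ⟨ρ₁, hρ₁, H1⟩ := stub_transfer v hv
  obtain ⟨ρ₄, hρ₄, H4⟩ := h
  refine ⟨min ρA (min ρ₁ ρ₄), lt_min hρA (lt_min hρ₁ hρ₄), fun ρ hρ hlt => ?_⟩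
  obtain ⟨c, hc, hT⟩ := HA ρ hρ (hlt.trans_le (min_le_left _ _))
  exact H4 ρ hρ (hlt.trans_le ((min_le_right _ _).trans (min_le_right _ _))) (min c 1)
    (lt_min hc one_pos) (min_le_right c 1)
    (H1 ρ hρ (hlt.trans_le ((min_le_right _ _).trans (min_le_left _ _))) c hc hT)

/-- **`BoundaryTransferWeak` from the rewarded residual** for every admissible `v` (verbatim the hypothesis of
`periodicToDirichlet_of_upperBoundToBEC`). [folklore] -/
theorem boundaryTransferWeak_of_upperBoundToBEC
    (h : ∀ v : ℝ → ℝ≥0∞, IsRepulsiveFiniteRange v → ∃ ρ₄ : ℝ, 0 < ρ₄ ∧ ∀ ρ : ℝ, 0 < ρ → ρ < ρ₄ →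
      ∀ c : ℝ, 0 < c → c ≤ 1 → RewardedUpperBound v ρ c → HasGroundStateBEC v ρ) :
    Summit.AtomisticToContinuum.BoseEinsteinCondensation.Theses.BECPeriodicReduction.BoundaryTransferWeak :=
  fun v hv hA => boundaryTransferAt_of_upperBoundToBECAt hv (h v hv) hA

/-- **`BoundaryTransferWeak` from the planner's flat-mode residual `Unrewarding`** (via the landed
`upperBoundToBEC_of_unrewarding`). [folklore] -/
theorem boundaryTransferWeak_of_unrewarding (h : Unrewarding) :
    Summit.AtomisticToContinuum.BoseEinsteinCondensation.Theses.BECPeriodicReduction.BoundaryTransferWeak :=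
  boundaryTransferWeak_of_upperBoundToBEC (upperBoundToBEC_of_unrewarding h)

/-- **The `v = 0` instance of `BoundaryTransferWeak` holds outright**: its conclusion does, by the landed free
Dirichlet BEC `hasGroundStateBEC_zero` (every `ρ > 0`). [folklore] -/
theorem boundaryTransferAt_zero
    (_hA : ∃ ρ₀ : ℝ, 0 < ρ₀ ∧ ∀ ρ : ℝ, 0 < ρ → ρ < ρ₀ → ∃ c : ℝ, 0 < c ∧ TorusBECAt 0 ρ c) :
    ∃ ρ₀ : ℝ, 0 < ρ₀ ∧ ∀ ρ : ℝ, 0 < ρ → ρ < ρ₀ → HasGroundStateBEC 0 ρ :=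
  ⟨1, one_pos, fun _ hρ _ => hasGroundStateBEC_zero hρ⟩

end Summit.AtomisticToContinuum.BoseEinsteinCondensation.RewardPaysTheWall

end
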